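import Literature.AlgebraicGeometry.Frobenioids.ModelFrobenioidPreFrobenioid
import Literature.AlgebraicGeometry.Frobenioids.PadicFrobenioidThm12TypesProofs
import HarnessLib

/-!
# Frobenioids II, Theorem 1.2 (i): the `p`-adic Frobenioid is of isotropic type — PROOF

Mochizuki, *The geometry of Frobenioids II*, Kyushu J. Math. **62** (2008) 401–460, §1, Theorem 1.2 (i),
second sentence, p. 9 [cite: MochizukiFrdII2008, Thm 1.2 (i) p.9]: "For arbitrary `Λ`, the Frobenioid `C`
is of isotropic, model, `Aut`-ample, `Aut^sub`-ample, `End`-ample, and quasi-Frobenius-trivial type, but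
not of group-like type", with the printed proof "it follows from [FrdI], Theorem 5.2, (ii), that `C` is of
isotropic and model type".

PROOF-ONLY companion (node `FrdII:Thm1.2(i)`, second sentence, seat abc-iut-L1-d10; statements =
abc-iut-L1-t4's `PadicFrobenioidThm12.lean`). The ISOTROPIC clause is discharged here UNCONDITIONALLY for
the `p`-adic Frobenioid `C = d.frobenioid → F_Φ` of every `d : PadicFrd.Datum D p`: by abc-iut-found's
[FrdI] Thm. 5.2 (ii) `ModelFrobenioid.isIsotropic` (an isometric pre-step of a model Frobenioid whose `B`
is group-like is an isomorphism), whose one hypothesis — `B` objectwise group-like — holds because every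
element of `B(A) = K_A^× ×_{Φ₀^gp(A)} Φ^gp(A)` is a unit (`Datum.isUnit_B`, `PadicFrobenioidDatumLemmas`).
With the five Def. 1.2 clauses already proved in `PadicFrobenioidThm12TypesProofs.lean`, the assembled
schema `Thm12_i_types d V` now needs ONLY the "model type" slot `V.IsOfModelType` of the vocabulary record
(`thm12_i_types_of_isOfModelType`); that slot is a SCHEMA field (TODO-merge with [FrdI] Thm. 5.2 (ii)
"of model type", abc-iut-L1-t2/t3), not a claim about `C` that could be proved here.
Also recorded: every morphism of `C` is co-angular (`isCoAngular`, found's `ModelFrobenioid.isCoAngular`).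
No definitions; nothing here bears on [IUTchIII].
-/

namespace Literature.AlgebraicGeometry.Frobenioids

open CategoryTheory Opposite Function

universe w v u

/-- A commutative monoid all of whose elements are units is group-like ([FrdI] Def. 1.1 (i): integral,
saturated, of characteristic type, `M^char = 0`). Local copy (abc-iut-L1-d8 states the same lemma in its
staged `PadicFrobenioidIsFrobenioid.lean`; kept private here to avoid a name clash).
[cite: MochizukiFrdI2008, Def. 1.1 (i) p.19] -/
private theorem isGroupLike_of_forall_isUnit_d10 {M : Type w} [CommMonoid M] (h : ∀ b : M, IsUnit b) :
    IsGroupLike M := by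
  haveI : IsCancelMul M :=
    { mul_left_cancel := fun a b c habc => (h a).mul_left_cancel habc
      mul_right_cancel := fun a b c habc => (h a).mul_right_cancel habc }
  refine ⟨⟨isIntegral_iff_isCancelMul.mpr inferInstance, ⟨fun x n _ _ => ?_⟩, ⟨fun u a hua => ?_⟩⟩,
    ⟨fun x y => ?_⟩⟩
  · obtain ⟨a, b, hab⟩ := grothendieckGroup_exists_mul_of_eq_of x
    obtain ⟨v, hv⟩ := h b
    refine ⟨a * ↑v⁻¹, ?_⟩
    rw [map_mul, map_units_inv, hv, mul_inv_eq_iff_eq_mul]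
    exact hab.symm
  · have : (u : M) * a = 1 * a := by rw [hua, one_mul]
    exact Units.ext ((h a).mul_right_cancel this)
  · obtain ⟨a, rfl⟩ := Associates.mk_surjective x
    obtain ⟨b, rfl⟩ := Associates.mk_surjective y
    obtain ⟨ua, hua⟩ := h a
    obtain ⟨ub, hub⟩ := h b
    exact Associates.mk_eq_mk_iff_associated.mpr ⟨ua⁻¹ * ub, by
      rw [← hua, Units.val_mul, ← mul_assoc, Units.mul_inv, one_mul, hub]⟩

namespace PadicFrd

namespace Datum

variable {D : Type u} [Category.{v} D] {p : ℕ} [Fact p.Prime] (d : Datum D p)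

/-- `B(A) = K_A^× ×_{Φ₀^gp(A)} Φ^gp(A)` is group-like for every `A ∈ Ob(D)` (every element is a unit,
`Datum.isUnit_B`). [cite: MochizukiFrdII2008, Ex 1.1 (ii) p.8] -/
theorem isGroupLike_B (A : D) : IsGroupLike (d.B.obj (op A)) :=
  isGroupLike_of_forall_isUnit_d10 (d.isUnit_B (op A))

/-- `B` is (objectwise) group-like — the hypothesis of [FrdI] Thm. 5.2 on the datum `B → Φ^gp`.
[cite: MochizukiFrdII2008, Ex 1.1 (ii) p.8] -/
theorem objectwise_isGroupLike_B : Objectwise (fun M _ => IsGroupLike M) d.B :=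
  fun A => d.isGroupLike_B A

/-- **Thm. 1.2 (i)**: every object of the `p`-adic Frobenioid is isotropic — an isometric pre-step out
of it is an isomorphism ([FrdI] Thm. 5.2 (ii), found's `ModelFrobenioid.isIsotropic`).
[cite: MochizukiFrdII2008, Thm 1.2 (i) p.9] -/
theorem thm12_isIsotropic (X : d.frobenioid) : PreFrobenioid.IsIsotropic d.structureFunctor X :=
  ModelFrobenioid.isIsotropic d.objectwise_isGroupLike_B X

/-- **Thm. 1.2 (i)**, second sentence, ISOTROPIC clause DISCHARGED: "the Frobenioid `C` is of isotropic
… type" — "it follows from [FrdI], Theorem 5.2, (ii)" (FrdII p. 9). [cite: MochizukiFrdII2008, Thm 1.2 (i) p.9] -/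
theorem thm12_isOfIsotropicType : PreFrobenioid.IsOfIsotropicType d.structureFunctor :=
  fun X => d.thm12_isIsotropic X

/-- Every morphism of the `p`-adic Frobenioid is co-angular ([FrdI] Thm. 5.2 (ii) via found's
`ModelFrobenioid.isCoAngular`; used by [FrdI] Def. 1.3 (iii)(d)). [cite: MochizukiFrdII2008, Ex 1.1 (ii) p.8] -/
theorem isCoAngular {X Y : d.frobenioid} (φ : X ⟶ Y) :
    PreFrobenioid.IsCoAngular d.structureFunctor φ :=
  ModelFrobenioid.isCoAngular d.objectwise_isGroupLike_B φ

/-- **Thm. 1.2 (i), second sentence, assembled** with the isotropic clause discharged: of the seven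
clauses of the schema `Thm12_i_types d V` (`PadicFrobenioidThm12.lean`), six — isotropic, `Aut`-ample,
`Aut^sub`-ample, `End`-ample, quasi-Frobenius-trivial, not group-like — are now PROVED for every datum;
only the "model type" SLOT `V.IsOfModelType` of the vocabulary record remains an input (a schema field,
TODO-merge [FrdI] Thm. 5.2 (ii)). [cite: MochizukiFrdII2008, Thm 1.2 (i) p.9] -/
theorem thm12_i_types_of_isOfModelType (V : Thm12Vocab d) (hmodel : V.IsOfModelType) :
    Thm12_i_types d V :=
  d.thm12_i_types_of V d.thm12_isOfIsotropicType hmodel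

end Datum

end PadicFrd

end Literature.AlgebraicGeometry.Frobenioids
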